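import Mathlib
import Summits.CriticalPhenomena.Ising3DConformalLimit.Theses.GaussianScaleMixture
import Summits.CriticalPhenomena.Ising3DConformalLimit.Theorems.GaussianScaleMixtureCriticalTwoPointGSMExistsExchangeableRepOfRep
import Summits.CriticalPhenomena.Ising3DConformalLimit.Theorems.GaussianScaleMixtureCriticalTwoPointGSMJointSpectralMeasure
import Summits.CriticalPhenomena.Ising3DConformalLimit.Theorems.GaussianScaleMixtureCriticalTwoPointGSMConsFormAlternating
import Summits.CriticalPhenomena.Ising3DConformalLimit.Theorems.GaussianScaleMixtureCriticalTwoPointGSMMixedDifferenceLe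
import Summits.CriticalPhenomena.Ising3DConformalLimit.Theorems.GaussianScaleMixtureCriticalTwoPointGSMRpInterpolationUnique

/-!
# Line `Sketch`, canonical-lift spine (seat c1) — crux `CriticalTwoPointGSM` (stmt-CriticalPhenomena-8365)

Route `GaussianScaleMixture` of `Ising3DConformalLimit`; crux r2:
`⟨σ₀σ_x⟩⁺_{β_c}` on `ℤ³` is a Gaussian scale mixture in the squared coordinates.

This is the OS / Hartman–Watson **canonical-lift** transfer AT `β_c` (cards `hartman-watson-lift` ≈
`nine-direction-spectral-envelope`, Addendum "OS-anchoring"), driven by seat c1 IN PARALLEL with seat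
-1's cube/closed-cone reshape of the subcritical spine (`Lines/Sketch.lean`). All stubs of this file
were registered ADDITIVELY (`ledger workitem stub-add`); it is published as
`Lines/Sketch-canonical-lift.lean` and never replaces the registered skeleton.

## Objects

Write a site of `ℤ³` as `Fin.cons n z`, `n ∈ ℤ` (the reflection-positive "time" axis `e₀`),
`z ∈ ℤ²` (transverse). A point of the spectral side is `p : Fin 3 → ℝ` with `p 0 = λ ∈ [0,1]`
(transfer-matrix eigenvalue) and `(p 1, p 2) = k ∈ [-π,π]²` (transverse momentum); the joint kernel is
`λ^{|n|} cos(k·z)`.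

## Composition — CLOSED MODULO ONE PHYSICAL STUB

* `Theorems.jointSpectralMeasure` (JS; LANDED p102759, `…GSMJointSpectralMeasure.lean`, assembled
  from the landed wave-1 stubs `js_trigSum` p98539, `js_cesaroIdentity` p98906, `js_approximants`
  p99251, `js_pairCount_tendsto` p98252, `js_compactness` p98006): there is a probability measure `ρ`
  on `[0,1]×[-π,π]²` with `⟨σ₀σ_{(n,z)}⟩⁺_{β_c} = ∫ λ^{|n|} cos(k·z) dρ` for all `(n,z)` — the JOINT
  (axial × transverse) Källén–Lehmann measure (ADC21 Prop. 5.3/8.6 + Bochner in `k`, built by a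
  discrete-momentum Cesàro/DFT construction + Prokhorov, no Herglotz theorem).
* `Theorems.js_noAtom ∘ Theorems.js_momentDeterminacy` (LANDED p97888, p97855): any such `ρ` has
  `ρ{λ ≤ 0} = 0` (positive-definite transfer matrix) — protects RP from a spurious failure at `t → 0⁺`.
* `rpInterpolatedGSM` (RP, the PHYSICAL stub, crux-sized, OPEN — the only `sorry` of this file): for
  every such `ρ` the reflection-positive interpolation `t ↦ ∫ λ^t cos(k·z) dρ`, `t ≥ 0` REAL, is a
  Gaussian scale mixture jointly in `(t², z₁², z₂²)`. By Laplace uniqueness in `t²` this says exactly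
  that the canonical ½-stable (Hartman–Watson) slices `W(s,·) = ∫ h_a(s) cos(k·) dρ(a,k)` are 2D
  Gaussian scale mixtures — the lever of the two cards; exact for the lattice free field of every mass;
  a function of `G` alone (`Theorems.rpInterpolation_unique`, p100829); at integer `t` it is the crux.
* `criticalTwoPointGSM_of_rpInterpolatedGSM` (GL, glue, proved here) and the composition
  `CriticalTwoPointGSM_of : CriticalTwoPointGSM`.

## Dividends LANDED (not in the composition)

* `Theorems.consForm_alternating` (p100778): rung 0 — every axial quadratic form of the critical
  two-point function is completely monotone (unconditional).
* `Theorems.mixedDifference_le` (p100893): the planner's joint mixed difference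
  `G(n+1,0) + G(n,z) ≤ G(n,0) + G(n+1,z)` holds at `β_c` as a THEOREM — the instance
  `Disproof.mixedDiff_le` (there derived from the crux) can never kill the crux.
* `Theorems.rpInterpolation_unique` (p100829): the RP interpolation depends on `G` only.
* Literature infrastructure for the other eight mirror directions (wave 3, all landed):
  `Literature.MeasureTheory.Integral.hausdorffMoment_iff_alternating` /
  `hausdorffMoment_of_hankel_posSemidef` (Hausdorff's moment theorem; `[0,1]`-moments from bounded
  double-Hankel positivity — the form reflection positivity delivers), from
  `bernsteinWeights_sum_descFactorial` p105020, `bernsteinWeights_moment_tendsto` p104932,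
  `exists_measure_of_discreteMoments_tendsto` p105640, `hankel_shift_abs_le` p105095,
  `hankel_alternating` p105144 (assembly file `HausdorffMomentTheorem.lean` pending farm oleans).
-/

namespace Summit.CriticalPhenomena.Ising3DConformalLimit.Cruxes.CriticalTwoPointGSM.Lines.SketchCanonicalLift

open MeasureTheory Filter Topology
open Literature.Probability.LatticeModels
open Summit.CriticalPhenomena.Ising3DConformalLimit.Theses.GaussianScaleMixture (CriticalTwoPointGSM)
open scoped BigOperators

noncomputable section

/-! ## Stub: the physical input -/

/-- **STUB `rpInterpolatedGSM` (RP; physical input; OPEN, crux-sized).** For every joint spectral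
measure `ρ` of the critical two-point function (as in `Theorems.jointSpectralMeasure`) without mass at
`λ ≤ 0` (automatic, `Theorems.js_noAtom`), the reflection-positive interpolation `t ↦ ∫ λ^t cos(k·z) dρ`
(`t ≥ 0` real; `0^0 = 1`, `0^t = 0` for `t > 0`) is a Gaussian scale mixture jointly in
`(t², z₁², z₂²)`: there is ONE probability measure `ν` on `ℝ³` carried by the closed octant with
`∫ λ^t cos(k·z) dρ = ∫ exp(-(s₀t² + s₁z₁² + s₂z₂²)) dν(s)` for all real `t ≥ 0` and all `z ∈ ℤ²`.
Equivalent (Laplace uniqueness in `t²`) to: the canonical ½-stable (Hartman–Watson) slices of `ρ` are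
2D Gaussian scale mixtures. At integer `t` this is the crux. -/
theorem rpInterpolatedGSM : ∀ ρ : Measure (Fin 3 → ℝ), IsProbabilityMeasure ρ →
    ρ {p | 0 ≤ p 0 ∧ p 0 ≤ 1 ∧ ∀ j : Fin 2, -Real.pi ≤ p j.succ ∧ p j.succ ≤ Real.pi}ᶜ = 0 →
    ρ {p | p 0 ≤ 0} = 0 →
    (∀ (n : ℤ) (z : Fin 2 → ℤ), criticalTwoPoint 3 (Fin.cons n z) =
      ∫ p, (p 0) ^ n.natAbs * Real.cos (∑ j : Fin 2, p j.succ * (z j : ℝ)) ∂ρ) →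
    ∃ ν : Measure (Fin 3 → ℝ), IsProbabilityMeasure ν ∧ ν {s | ∃ i, s i < 0} = 0 ∧
      ∀ t : ℝ, 0 ≤ t → ∀ z : Fin 2 → ℤ,
        ∫ p, (p 0) ^ t * Real.cos (∑ j : Fin 2, p j.succ * (z j : ℝ)) ∂ρ =
          ∫ s, Real.exp (-(s 0 * t ^ 2 + ∑ j : Fin 2, s j.succ * ((z j : ℝ)) ^ 2)) ∂ν := by
  sorry

/-! ## Glue (proved here) -/

/-- A site of `ℤ³` is `Fin.cons` of its first coordinate and its tail. -/
theorem cons_self_tail (x : Site 3) : (Fin.cons (x 0) (Fin.tail x) : Site 3) = x :=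
  Fin.cons_self_tail x

/-- The quadratic form of the crux kernel splits along `e₀`:
`∑ᵢ sᵢ xᵢ² = s₀ x₀² + ∑ⱼ s_{j+1} x_{j+1}²`. -/
theorem sum_sq_split (s : Fin 3 → ℝ) (x : Site 3) :
    ∑ i, s i * ((x i : ℝ)) ^ 2 =
      s 0 * (((x 0 : ℤ) : ℝ)) ^ 2 + ∑ j : Fin 2, s j.succ * (((Fin.tail x j : ℤ) : ℝ)) ^ 2 := by
  rw [Fin.sum_univ_succ]
  rfl

/-- **GL (glue).** The joint spectral measure (with no mass at `λ ≤ 0`) and the RP-interpolated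
GSM give the crux: specialise the interpolation at `t = |x₀|` (where `λ^{|x₀|}` is the integer power
and `|x₀|² = x₀²`), reassemble `x = (x₀, tail x)`, and `S₃`-symmetrise the mixing measure
(`Theorems.exists_exchangeable_rep_of_rep`, p88466). -/
theorem criticalTwoPointGSM_of_rpInterpolatedGSM
    (hJS : ∃ ρ : Measure (Fin 3 → ℝ), IsProbabilityMeasure ρ ∧
      ρ {p | 0 ≤ p 0 ∧ p 0 ≤ 1 ∧ ∀ j : Fin 2, -Real.pi ≤ p j.succ ∧ p j.succ ≤ Real.pi}ᶜ = 0 ∧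
      ∀ (n : ℤ) (z : Fin 2 → ℤ), criticalTwoPoint 3 (Fin.cons n z) =
        ∫ p, (p 0) ^ n.natAbs * Real.cos (∑ j : Fin 2, p j.succ * (z j : ℝ)) ∂ρ)
    (hNA : ∀ ρ : Measure (Fin 3 → ℝ), IsProbabilityMeasure ρ →
      ρ {p | 0 ≤ p 0 ∧ p 0 ≤ 1 ∧ ∀ j : Fin 2, -Real.pi ≤ p j.succ ∧ p j.succ ≤ Real.pi}ᶜ = 0 →
      (∀ (n : ℤ) (z : Fin 2 → ℤ), criticalTwoPoint 3 (Fin.cons n z) =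
        ∫ p, (p 0) ^ n.natAbs * Real.cos (∑ j : Fin 2, p j.succ * (z j : ℝ)) ∂ρ) →
      ρ {p | p 0 ≤ 0} = 0)
    (hRP : ∀ ρ : Measure (Fin 3 → ℝ), IsProbabilityMeasure ρ →
      ρ {p | 0 ≤ p 0 ∧ p 0 ≤ 1 ∧ ∀ j : Fin 2, -Real.pi ≤ p j.succ ∧ p j.succ ≤ Real.pi}ᶜ = 0 →
      ρ {p | p 0 ≤ 0} = 0 →
      (∀ (n : ℤ) (z : Fin 2 → ℤ), criticalTwoPoint 3 (Fin.cons n z) =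
        ∫ p, (p 0) ^ n.natAbs * Real.cos (∑ j : Fin 2, p j.succ * (z j : ℝ)) ∂ρ) →
      ∃ ν : Measure (Fin 3 → ℝ), IsProbabilityMeasure ν ∧ ν {s | ∃ i, s i < 0} = 0 ∧
        ∀ t : ℝ, 0 ≤ t → ∀ z : Fin 2 → ℤ,
          ∫ p, (p 0) ^ t * Real.cos (∑ j : Fin 2, p j.succ * (z j : ℝ)) ∂ρ =
            ∫ s, Real.exp (-(s 0 * t ^ 2 + ∑ j : Fin 2, s j.succ * ((z j : ℝ)) ^ 2)) ∂ν) :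
    CriticalTwoPointGSM := by
  obtain ⟨ρ, hPρ, hsuppρ, hrepρ⟩ := hJS
  obtain ⟨ν, hPν, hoct, hν⟩ := hRP ρ hPρ hsuppρ (hNA ρ hPρ hsuppρ hrepρ) hrepρ
  -- the representation of the crux, before symmetrisation
  have hrep : ∀ x : Site 3, criticalTwoPoint 3 x = ∫ s, Real.exp (-∑ i, s i * ((x i : ℝ)) ^ 2) ∂ν := by
    intro x
    have h1 := hrepρ (x 0) (Fin.tail x)
    rw [cons_self_tail] at h1
    have h2 := hν ((x 0).natAbs : ℝ) (Nat.cast_nonneg _) (Fin.tail x)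
    -- `λ ^ (|x₀| : ℝ) = λ ^ |x₀|` (real power at a natural exponent)
    have h2' : ∫ p, (p 0) ^ (x 0).natAbs * Real.cos (∑ j : Fin 2, p j.succ * ((Fin.tail x j : ℤ) : ℝ)) ∂ρ =
        ∫ s, Real.exp (-(s 0 * (((x 0).natAbs : ℝ)) ^ 2 +
          ∑ j : Fin 2, s j.succ * (((Fin.tail x j : ℤ) : ℝ)) ^ 2)) ∂ν := by
      rw [← h2]
      refine integral_congr_ae (Eventually.of_forall fun p => ?_)
      simp only [Real.rpow_natCast]
    rw [h1, h2']
    refine integral_congr_ae (Eventually.of_forall fun s => ?_)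
    simp only
    rw [sum_sq_split]
    congr 3
    rw [Nat.cast_natAbs, Int.cast_abs, sq_abs]
  exact Theorems.exists_exchangeable_rep_of_rep ν hPν hoct hrep

/-! ## The composition -/

/-- **Skeleton theorem (canonical-lift spine).** The crux `CriticalTwoPointGSM` from: the joint
spectral measure (`Theorems.jointSpectralMeasure`, LANDED), the absence of spectral mass at `λ = 0`
(`Theorems.js_noAtom ∘ Theorems.js_momentDeterminacy`, LANDED) and the RP-interpolated
Gaussian-scale-mixture structure (`rpInterpolatedGSM`, the physical input — the ONLY stub). -/
theorem CriticalTwoPointGSM_of : CriticalTwoPointGSM :=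
  criticalTwoPointGSM_of_rpInterpolatedGSM Theorems.jointSpectralMeasure
    (Theorems.js_noAtom Theorems.js_momentDeterminacy) rpInterpolatedGSM

end

end Summit.CriticalPhenomena.Ising3DConformalLimit.Cruxes.CriticalTwoPointGSM.Lines.SketchCanonicalLift
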